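/-
Copyright (c) 2026. All rights reserved.
Released under Apache 2.0 license as described in the file LICENSE.
Authors: abc-iut cell, prover seat abc-iut-w4-d095 (wave 4), over the statements of abc-iut-L4-t3
(`LogFrobeniusObservables.lean`, `LogFrobeniusIncompatibility.lean`), the reductions of abc-iut-w5-d097
(`LogFrobeniusLogWallOfObstruction.lean`, `LogFrobeniusNotSimCompatOfObstruction.lean`) and the MLF Galois data of
abc-iut-L4-t2 (`MLFGaloisModel.lean`, `GaloisPadicLogMLF.lean`).
-/
import Literature.AnabelianGeometry.AbsoluteAnabelian.LogFrobeniusNotSimCompatOfObstruction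
import Literature.AnabelianGeometry.AbsoluteAnabelian.GaloisPadicLogMLF
import Mathlib.CategoryTheory.Types.Basic
import HarnessLib

/-!
# [AbsTopIII] Corollary 5.5 (iv), print-faithful sentences 1 and 2: the NONARCHIMEDEAN ORIGIN of the two-path
# obstruction (the Lemma 3.4 mechanism, set-theoretically)

S. Mochizuki, *Topics in absolute anabelian geometry III: global reconstruction algorithms*, J. Math. Sci. Univ.
Tokyo 22 (2015) 939–1156 [MochizukiAbsTopIII2015]; locators = pages of the author's manuscript
(`paper:url-5493eb38cbb7`): Cor 5.5 (iv) p. 131, proof pp. 132–133; the proof of Cor 3.6 (iv) p. 81 l. 27–42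
("by writing out explicitly the meaning of such an equality `ζ'₁ = ζ₂`, we conclude that we obtain a contradiction to
Lemma 3.4"); Def 5.4 (iii) p. 126 (the nonarchimedean graph `Γ⃗^log_v`: `𝒪^×_k̄ ↪ k̄^× ↪ k̄`, the shell-arrow
`𝒪^×_k̄ → k~` "the logarithm", `k~ →(id) k~`); Def 3.1 (i) p. 66 (`log_k̄ : 𝒪^×_k̄ → k̄`, `(𝒪^×_k̄)^pf = 𝒪^×_k̄/𝒪^μ_k̄`).

PROOF-ONLY: no new notion, no new `Prop`, no model setting.

abc-iut-w5-d097 reduced BOTH print-faithful sentences of Cor 5.5 (iv) — sentence 1, `Cor55LogWall T` (FACT-LIST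
F-3082), and sentence 2, `Cor55NotSimultaneouslyCompatible T` (F-3190) — to ONE component-level input at one
nonarchimedean place `v₀` (`cor55LogWall_of_nonarchObstruction`, `cor55NotSimultaneouslyCompatible_of_nonarchObstruction`,
same binder): in the two-path configuration `𝒪^× ↪ k̄^× ↪ k̄`, `k~ →(id) k~` versus the shell-arrow `𝒪^× →(log) k~`,
for no isomorphism `a : x₀ ⥲ log(x₀)` does `λ_{𝒪^×}(a) ≫ ι_{ε₁} ≫ ι_{ε₂} ≫ ι_{ε₃} = ι_{ε₄}` hold at `x₀`.  This file
locates that input in print's arrows, set-theoretically: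

* `LogFrobeniusSetting.cor55LogWall_and_notSimCompat_of_iota_injective` — **for ANY setting and ANY `TS`-datum**:
  if `𝒩_{v₀}` carries a set-valued functor `Ψ` (print: the objects of `𝒩_v` are topological spaces, Def 5.4 (iv)) under
  which, in every two-path configuration at `v₀`, the components of the three type-(1) arrows `ι_{ε₁}`, `ι_{ε₂}`,
  `ι_{ε₃}` are INJECTIVE (print: two natural inclusions and an identity) while the component of the type-(2) arrow
  `ι_{ε₄}` is NOT injective (print: the logarithm `𝒪^×_k̄ → k̄` kills the roots of unity `𝒪^μ_k̄`, Def 3.1 (i) /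
  Lemma 3.4), then the two-path obstruction holds — a composite of injective maps after the bijection `λ_{𝒪^×}(a)` is
  injective, so it is not the non-injective `ι_{ε₄}` — hence `L.Cor55LogWall T ∧ L.Cor55NotSimultaneouslyCompatible T`.
* `GaloisPadicLog.not_injOn_log_unitSubmonoid` / `MLFClosure.not_injOn_galoisPadicLog_unitSubmonoid` — **the printed
  type-(2) arrow IS non-injective**: for every MLF-Galois `TM`-datum of abc-iut-L4-t2 (`GaloisPadicLog k K`, Def 3.1
  (i)) over a field of characteristic `≠ 2`, in particular for the genuine `log_k̄` of an `MLFClosure`, `log_k̄` is not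
  injective on `𝒪^×_k̄` (`log(−1) = log(1) = 0`).  ARROW-LEVEL: a §5 setting whose NONARCHIMEDEAN components are these
  genuine MLF arrows is not constructed here (the sibling `LogFrobeniusLogWallArchOrigin.lean` does the archimedean
  components); at such a setting the first theorem would discharge both sentences with `Ψ :=` underlying sets.

Refereed pre-IUT material; OUR kernel check of typed statements; nothing here bears on [IUTchIII] Cor. 3.12; no side
taken; typed ≠ proved; a located input is not a node-level discharge.
-/

set_option autoImplicit false

universe w u

open CategoryTheory

namespace Literature.AnabelianGeometry.AbsoluteAnabelian

/-! ## Part 1. The set-theoretic sufficient condition (any setting, any `TS`-datum) -/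

namespace LogFrobeniusSetting

variable {Vmod : Type u} {isArc : Vmod → Bool} (L : LogFrobeniusSetting Vmod isArc)

/-- The image under a set-valued functor of an isomorphism is injective. [folklore] -/
private theorem injective_map_of_isIso {C : Type*} [Category C] (Ψ : C ⥤ Type w) {A B : C} (f : A ⟶ B)
    [IsIso f] : Function.Injective (Ψ.map f : Ψ.obj A → Ψ.obj B) :=
  ((isIso_iff_bijective (Ψ.map f)).mp inferInstance).1

/-- The image under a set-valued functor of an isomorphism is surjective. [folklore] -/
private theorem surjective_map_of_isIso {C : Type*} [Category C] (Ψ : C ⥤ Type w) {A B : C} (f : A ⟶ B)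
    [IsIso f] : Function.Surjective (Ψ.map f : Ψ.obj A → Ψ.obj B) :=
  ((isIso_iff_bijective (Ψ.map f)).mp inferInstance).2

/-- **[AbsTopIII] Cor 5.5 (iv), print-faithful sentences 1 AND 2, from injectivity / non-injectivity of the printed
arrows at one nonarchimedean place.**  For any setting `L`, `TS`-datum `T`, nonarchimedean place `v₀`, object `x₀` of
`𝒳` and set-valued functor `Ψ` on `𝒩_{v₀}`: if in every two-path configuration `νu →(ε₁) νm →(ε₂) spaceLink`,
`postLog →(ε₃) νc`, `νu →(ε₄) νc` of `Γ⃗^log_{v₀}` (at a nonarchimedean place there is exactly the printed one,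
`𝒪^× ↪ k̄^× ↪ k̄`, `k~ →(id) k~`, `𝒪^× →(log) k~`) the `Ψ`-images of the components of `ι_{ε₁}`, `ι_{ε₂}` (at
`log(x₀)`) and `ι_{ε₃}` (at `x₀`) are injective and that of `ι_{ε₄}` (at `x₀`) is not, then abc-iut-w5-d097's two-path
obstruction holds at `(v₀, x₀)` ("writing out explicitly the meaning of such an equality `ζ'₁ = ζ₂` … a contradiction
to Lemma 3.4", proof of Cor 3.6 (iv) p. 81), hence `L.Cor55LogWall T` (sentence 1) and
`L.Cor55NotSimultaneouslyCompatible T` (sentence 2). [cite: MochizukiAbsTopIII2015, Cor 5.5 (iv) p. 131] -/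
theorem cor55LogWall_and_notSimCompat_of_iota_injective (T : L.TSHomotopies) (v₀ : Vmod)
    (hv₀ : isArc v₀ = false) (x₀ : L.X) (Ψ : L.N v₀ ⥤ Type w)
    (hΨ : ∀ (νu νm νc : LogVertex (isArc v₀)), νu.isPostLog = false → νm.isPostLog = false →
      νc.isPostLog = false → ∀ (ε₁ : LogEdgeTS (isArc v₀) νu νm)
      (ε₂ : LogEdgeTS (isArc v₀) νm (LogVertex.spaceLink (isArc v₀)))
      (ε₃ : LogEdgeTS (isArc v₀) (LogVertex.postLog (isArc v₀)) νc) (ε₄ : LogEdgeTS (isArc v₀) νu νc),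
      Function.Injective (Ψ.map ((T.iota v₀ ε₁).app (L.log.obj x₀)) : _ → _) ∧
        Function.Injective (Ψ.map ((T.iota v₀ ε₂).app (L.log.obj x₀)) : _ → _) ∧
          Function.Injective (Ψ.map ((T.iota v₀ ε₃).app x₀) : _ → _) ∧
            ¬ Function.Injective (Ψ.map ((T.iota v₀ ε₄).app x₀) : _ → _)) :
    L.Cor55LogWall T ∧ L.Cor55NotSimultaneouslyCompatible T := by
  have obstruction : ∀ (νu νm νc : LogVertex (isArc v₀)) (_ : νu.isPostLog = false) (_ : νm.isPostLog = false)
      (_ : νc.isPostLog = false) (ε₁ : LogEdgeTS (isArc v₀) νu νm)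
      (ε₂ : LogEdgeTS (isArc v₀) νm (LogVertex.spaceLink (isArc v₀)))
      (ε₃ : LogEdgeTS (isArc v₀) (LogVertex.postLog (isArc v₀)) νc) (ε₄ : LogEdgeTS (isArc v₀) νu νc)
      (a : x₀ ⟶ L.log.obj x₀), IsIso a →
      ∀ (m₁ : (L.lam v₀ νu ⋙ L.forget v₀).obj (L.log.obj x₀) ⟶ (L.lam v₀ νm ⋙ L.forget v₀).obj (L.log.obj x₀))
        (m₂ : (L.lam v₀ νm ⋙ L.forget v₀).obj (L.log.obj x₀) ⟶
          (L.lam v₀ (LogVertex.spaceLink (isArc v₀)) ⋙ L.forget v₀).obj (L.log.obj x₀))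
        (m₃ : (L.lam v₀ (LogVertex.spaceLink (isArc v₀)) ⋙ L.forget v₀).obj (L.log.obj x₀) ⟶
          (L.lam v₀ νc ⋙ L.forget v₀).obj x₀)
        (m₄ : (L.lam v₀ νu ⋙ L.forget v₀).obj x₀ ⟶ (L.lam v₀ νc ⋙ L.forget v₀).obj x₀),
        HEq m₁ ((T.iota v₀ ε₁).app (L.log.obj x₀)) → HEq m₂ ((T.iota v₀ ε₂).app (L.log.obj x₀)) →
        HEq m₃ ((T.iota v₀ ε₃).app x₀) → HEq m₄ ((T.iota v₀ ε₄).app x₀) →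
          (L.lam v₀ νu ⋙ L.forget v₀).map a ≫ m₁ ≫ m₂ ≫ m₃ ≠ m₄ := by
    intro νu νm νc hu hm hc ε₁ ε₂ ε₃ ε₄ a ha m₁ m₂ m₃ m₄ hm₁ hm₂ hm₃ hm₄ heq
    obtain ⟨i₁, i₂, i₃, n₄⟩ := hΨ νu νm νc hu hm hc ε₁ ε₂ ε₃ ε₄
    have hpl : (LogVertex.postLog (isArc v₀)).isPostLog = true := by
      generalize isArc v₀ = b
      cases b <;> rfl
    -- the four object identifications (the path functors `Λ_ν`, `λ_{spaceLink} = λ_{postLog}` are propositional)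
    have h₁ : (L.lam v₀ νu ⋙ L.forget v₀).obj (L.log.obj x₀) =
        ((frobeniusTwist L.log νu.isPostLog ⋙ L.lam v₀ νu) ⋙ L.forget v₀).obj (L.log.obj x₀) := by
      rw [hu]; rfl
    have h₂ : (L.lam v₀ νm ⋙ L.forget v₀).obj (L.log.obj x₀) =
        ((frobeniusTwist L.log νm.isPostLog ⋙ L.lam v₀ νm) ⋙ L.forget v₀).obj (L.log.obj x₀) := by
      rw [hm]; rfl
    have h₃ : (L.lam v₀ (LogVertex.spaceLink (isArc v₀)) ⋙ L.forget v₀).obj (L.log.obj x₀) =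
        ((frobeniusTwist L.log (LogVertex.postLog (isArc v₀)).isPostLog ⋙
          L.lam v₀ (LogVertex.postLog (isArc v₀))) ⋙ L.forget v₀).obj x₀ := by
      rw [hpl, L.lam_spaceLink_eq_postLog]; rfl
    have h₄ : (L.lam v₀ νu ⋙ L.forget v₀).obj x₀ =
        ((frobeniusTwist L.log νu.isPostLog ⋙ L.lam v₀ νu) ⋙ L.forget v₀).obj x₀ := by
      rw [hu]; rfl
    have e₁ := (conj_eqToHom_iff_heq' m₁ ((T.iota v₀ ε₁).app (L.log.obj x₀)) h₁ rfl).mpr hm₁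
    have e₂ := (conj_eqToHom_iff_heq' m₂ ((T.iota v₀ ε₂).app (L.log.obj x₀)) h₂ rfl).mpr hm₂
    have e₃ := (conj_eqToHom_iff_heq' m₃ ((T.iota v₀ ε₃).app x₀) h₃ rfl).mpr hm₃
    have e₄ := (conj_eqToHom_iff_heq' m₄ ((T.iota v₀ ε₄).app x₀) h₄ rfl).mpr hm₄
    -- the type-(1) factors are injective under `Ψ`
    have j₁ : Function.Injective (Ψ.map m₁ : _ → _) := by
      rw [e₁]
      simp only [eqToHom_refl, Category.comp_id, Functor.map_comp, types_comp]
      exact i₁.comp (injective_map_of_isIso Ψ _)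
    have j₂ : Function.Injective (Ψ.map m₂ : _ → _) := by
      rw [e₂]
      simp only [eqToHom_refl, Category.comp_id, Functor.map_comp, types_comp]
      exact i₂.comp (injective_map_of_isIso Ψ _)
    have j₃ : Function.Injective (Ψ.map m₃ : _ → _) := by
      rw [e₃]
      simp only [eqToHom_refl, Category.comp_id, Functor.map_comp, types_comp]
      exact i₃.comp (injective_map_of_isIso Ψ _)
    haveI : IsIso a := ha
    have ja : Function.Injective (Ψ.map ((L.lam v₀ νu ⋙ L.forget v₀).map a) : _ → _) :=
      injective_map_of_isIso Ψ _
    -- "writing out explicitly the meaning" of `ζ'₁ = ζ₂`: the type-(2) arrow would be injective under `Ψ`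
    have j₄ : Function.Injective (Ψ.map m₄ : _ → _) := by
      rw [← heq]
      simp only [Functor.map_comp, types_comp]
      exact ((j₃.comp j₂).comp j₁).comp ja
    rw [e₄] at j₄
    simp only [eqToHom_refl, Category.comp_id, Functor.map_comp, types_comp] at j₄
    exact n₄ (Function.Injective.of_comp_right j₄ (surjective_map_of_isIso Ψ _))
  exact ⟨L.cor55LogWall_of_nonarchObstruction T v₀ hv₀ x₀ obstruction,
    L.cor55NotSimultaneouslyCompatible_of_nonarchObstruction T v₀ hv₀ x₀ obstruction⟩

end LogFrobeniusSetting

/-! ## Part 2. The printed type-(2) arrow is non-injective: `log_k̄` kills `𝒪^μ_k̄` (Def 3.1 (i), Lemma 3.4) -/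

section MLF

variable {k : Type u} [Field k] [ValuativeRel k] {K : Type u} [Field K] [Algebra k K]

/-- `−1 ∈ 𝒪^×_k̄`. [cite: MochizukiAbsTopIII2015, Definition 3.1 (i) p.66] -/
theorem neg_one_mem_unitSubmonoid : (-1 : K) ∈ unitSubmonoid k K :=
  ⟨Subalgebra.neg_mem _ (Subalgebra.one_mem _), -1, Subalgebra.neg_mem _ (Subalgebra.one_mem _), by ring⟩

/-- **`log_k̄` is not injective on `𝒪^×_k̄`** (over any field of characteristic `≠ 2`, in particular over an MLF):
`log(−1) = log(1) = 0` while `−1 ≠ 1` — the logarithm kills the torsion `𝒪^μ_k̄` (Def 3.1 (i): `(𝒪^×_k̄)^pf` is the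
quotient by the roots of unity), the set-theoretic content of the type-(2) arrow in the proof of Cor 3.6 (iv) /
Lemma 3.4 as used by Cor 5.5 (iv). [cite: MochizukiAbsTopIII2015, Definition 3.1 (i) p.66] -/
theorem GaloisPadicLog.not_injOn_log_unitSubmonoid [CharZero K] (L : GaloisPadicLog k K) :
    ¬ Set.InjOn L.log (unitSubmonoid k K) := by
  intro h
  have h1 : L.log (1 : K) = 0 := L.log_eq_zero_of_pow_eq_one (unitSubmonoid k K).one_mem one_pos (one_pow 1)
  have h2 : L.log (-1 : K) = 0 :=
    L.log_eq_zero_of_pow_eq_one neg_one_mem_unitSubmonoid two_pos (by norm_num)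
  have h3 : (-1 : K) = 1 := h neg_one_mem_unitSubmonoid (unitSubmonoid k K).one_mem (h2.trans h1.symm)
  have h4 : (2 : K) = 0 := by
    have := congrArg (fun x : K => x + 1) h3
    simp only [neg_add_cancel] at this
    rw [one_add_one_eq_two] at this
    exact this.symm
  exact two_ne_zero h4

/-- **The genuine `log_k̄` of an MLF is not injective on `𝒪^×_k̄`**: instance of the previous lemma for the MLF-Galois
data of abc-iut-L4-t2 (`MLFClosure`, its `galoisPadicLog`; `k̄` has characteristic `0`).
[cite: MochizukiAbsTopIII2015, Definition 3.1 (i) p.66] -/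
theorem MLFClosure.not_injOn_galoisPadicLog_unitSubmonoid (C : MLFClosure.{0}) :
    ¬ Set.InjOn C.galoisPadicLog.log (unitSubmonoid C.k C.K) :=
  haveI : CharZero C.K := charZero_of_injective_algebraMap (algebraMap C.k C.K).injective
  C.galoisPadicLog.not_injOn_log_unitSubmonoid

end MLF

end Literature.AnabelianGeometry.AbsoluteAnabelian
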